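import Summits.NavierStokesRegularity.NavierStokesRegularity.Theses.AxisymmetricExtremality
import Summits.NavierStokesRegularity.NavierStokesRegularity.Theorems.AxisymmetricExtremalityAxisymmetricKatoGlobalStubSeregin2020TypeIINoSwirlRegularRepr
import Summits.NavierStokesRegularity.NavierStokesRegularity.Theorems.AxisymmetricExtremalityAxisymmetricKatoGlobalStubSeregin2020TypeIINoSwirlSingularStructure
import Summits.NavierStokesRegularity.NavierStokesRegularity.Theorems.AxisymmetricExtremalityAxisymmetricKatoGlobalStubSeregin2020TypeIINoSwirlCoreRim
import Summits.NavierStokesRegularity.NavierStokesRegularity.Theorems.AxisymmetricExtremalityAxisymmetricKatoGlobalStubSeregin2020TypeIISwirlVanishesClass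
import Literature.Analysis.FluidPDE.KNSSSwirlSupNonpos
import HarnessLib

/-!
# Seregin 2020, proof of Thm 2.1, the `Γ ≡ 0` step: one smooth representative of the ancient
# limit on the whole complement of its backward-singular set

Helper toward the stub `stub_seregin2020TypeII` of the crux `AxisymmetricKatoGlobal` (= the named
fact `Literature.Analysis.FluidPDE.Seregin2020_axisymmetricSingularPoint_typeII`, G. Seregin,
Anal. Math. Phys. 10 (2020) Paper 46 = arXiv:2006.04140, Thm 2.1). About the ancient limit
`(u, p)` with the properties (𝒜) the printed proof says (arXiv p. 7): "there exists a closed set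
`S^Γ` in `Q₋`, whose 1D-parabolic measure … is equal to zero and `x' = 0` for any
`z = (x', x₃, t) ∈ S^Γ`, such that any spatial derivative of `u` (and thus of `Γ`) is Hölder
continuous in `Q₋ ∖ S^Γ`." The `Γ ≡ 0` step (Lemma 2.2 applied to `Γ₀ ∓ Γ`) needs ONE function
`Γ` on the whole of `Q₋ = {t < 0}`, i.e. one representative `V` of the velocity which is smooth on
the whole open set of backward-regular points, across all the cylinders `Q(a)`, `a > 0`, in which
the limit is a suitable weak solution. This file glues the per-cylinder representatives of
`exists_isSmoothAxisymmetricSolutionOn_of_regular`: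

* `isSmoothAxisymmetricSolutionOn_congr` — the Seregin–Zajaczkowski class is transported along
  pointwise equality on the (rotation invariant) open set;
* `volume_setOf_cylRadius_snd_eq_zero` — `ℝ × {x' = 0}` is Lebesgue-null in space–time;
* `exists_smooth_repr_off_backwardSingular` — for `(w, π)` suitable in every `Q(a)` with
  axisymmetric slices and `Σ = {(t, x) | t ≤ 0, w ∉ L_∞(Q((t,x), r)) ∀ r > 0}` its backward-singular
  set (closed, on the axis, `𝒫¹`-null: `ancientLimit_backwardSingular_structure`), there is ONE
  `V` with `w = V` a.e. on every `Q(a)` and `(V, π)` in the class `IsSmoothAxisymmetricSolutionOn O`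
  on every rotation invariant open `O ⊆ Q(a) ∖ Σ`.

## References

* G. Seregin, Anal. Math. Phys. 10 (2020), Paper 46 = arXiv:2006.04140, proof of Thm. 2.1,
  structure of `S^Γ` (arXiv p. 7). [Seregin2020]
* G. Seregin, W. Zajaczkowski, SIAM J. Math. Anal. 39 (2007) 669–685, §3. [SereginZajaczkowski2007]
-/

-- the problem directory repeats the summit name (D-0017); core's `dupNamespace` linter fires
set_option linter.dupNamespace false

noncomputable section

open MeasureTheory Set Function Filter Topology TopologicalSpace Metric
open scoped NNReal ENNReal

namespace Summit.NavierStokesRegularity.NavierStokesRegularity.Theorems.AxisymmetricKatoGlobal.EulerScaling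

open Literature.Analysis.FluidPDE Literature.Analysis.FluidPDE.SereginZajaczkowski2007
  Literature.Analysis.FluidPDE.SereginSverak2009

/-! ### Transport of the Seregin–Zajaczkowski class along pointwise equality -/

/-- **The class `IsSmoothAxisymmetricSolutionOn S` only depends on the values on `S`.** If
`(V, P)` is in the class on the open, rotation invariant `S` and `W = V` at every point of `S`,
then `(W, P)` is in the class on `S`: suitability passes along a.e. equality
(`IsSuitableWeakSolutionOn.congr_ae`), the symmetry is pointwise on `S`, and slice smoothness and
the iterated spatial derivatives at a point only see the germ of the slice, which is unchanged
(the slice of `S` through a point is an open neighbourhood). [folklore] -/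
theorem isSmoothAxisymmetricSolutionOn_congr {S : Opens (ℝ × EuclideanSpace ℝ (Fin 3))}
    {V W : ℝ → EuclideanSpace ℝ (Fin 3) → EuclideanSpace ℝ (Fin 3)}
    {P : ℝ → EuclideanSpace ℝ (Fin 3) → ℝ} (hV : IsSmoothAxisymmetricSolutionOn S V P)
    (hSrot : ∀ θ : ℝ, ∀ z ∈ (S : Set (ℝ × EuclideanSpace ℝ (Fin 3))),
      ((z.1, rotZ θ z.2) : ℝ × EuclideanSpace ℝ (Fin 3)) ∈ (S : Set (ℝ × EuclideanSpace ℝ (Fin 3))))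
    (hVW : ∀ z ∈ (S : Set (ℝ × EuclideanSpace ℝ (Fin 3))), V z.1 z.2 = W z.1 z.2) :
    IsSmoothAxisymmetricSolutionOn S W P := by
  have hSo : IsOpen (S : Set (ℝ × EuclideanSpace ℝ (Fin 3))) := S.isOpen
  -- the slices agree near every point of `S`
  have hslice : ∀ z ∈ (S : Set (ℝ × EuclideanSpace ℝ (Fin 3))), W z.1 =ᶠ[𝓝 z.2] V z.1 := by
    intro z hz
    have hmk : Continuous fun y : EuclideanSpace ℝ (Fin 3) => ((z.1, y) : ℝ × EuclideanSpace ℝ (Fin 3)) :=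
      continuous_const.prodMk continuous_id
    have hzp : z.2 ∈ (fun y : EuclideanSpace ℝ (Fin 3) => ((z.1, y) : ℝ × EuclideanSpace ℝ (Fin 3))) ⁻¹'
        (S : Set (ℝ × EuclideanSpace ℝ (Fin 3))) := by simpa using hz
    filter_upwards [(hSo.preimage hmk).mem_nhds hzp] with y hy
    exact (hVW (z.1, y) hy).symm
  refine ⟨?_, ?_, ?_, ?_⟩
  · exact hV.suitable.congr_ae
      (ae_restrict_of_forall_mem hSo.measurableSet fun z hz => by
        simpa only [uncurry] using hVW z hz)
      (Eventually.of_forall fun _ => rfl)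
  · intro θ z hz
    rw [← hVW z hz, ← hVW (z.1, rotZ θ z.2) (hSrot θ z hz)]
    exact hV.axisymmetric θ z hz
  · intro z hz
    exact (hV.contDiffAt z hz).congr_of_eventuallyEq (hslice z hz)
  · intro n z hz
    obtain ⟨U, hU, C, r, hr, hH⟩ := hV.holder n z hz
    refine ⟨U, hU, C, r, hr, fun a ha b hb => ?_⟩
    have ea : iteratedFDeriv ℝ n (W a.1) a.2 = iteratedFDeriv ℝ n (V a.1) a.2 :=
      ((hslice a ha.2).iteratedFDeriv ℝ n).eq_of_nhds
    have eb : iteratedFDeriv ℝ n (W b.1) b.2 = iteratedFDeriv ℝ n (V b.1) b.2 :=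
      ((hslice b hb.2).iteratedFDeriv ℝ n).eq_of_nhds
    simp only [ea, eb]
    exact hH a ha b hb

/-! ### `ℝ × {x' = 0}` is null -/

/-- `ℝ × {x' = 0}` is Lebesgue-null in `ℝ × ℝ³`. [folklore] -/
theorem volume_setOf_cylRadius_snd_eq_zero :
    volume {z : ℝ × EuclideanSpace ℝ (Fin 3) | cylRadius z.2 = 0} = 0 := by
  have h : {z : ℝ × EuclideanSpace ℝ (Fin 3) | cylRadius z.2 = 0} =
      (univ : Set ℝ) ×ˢ {x : EuclideanSpace ℝ (Fin 3) | cylRadius x = 0} := by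
    ext z
    simp [mem_prod]
  rw [h, Measure.volume_eq_prod, Measure.prod_prod, volume_cylRadius_eq_zero, mul_zero]

/-! ### Two tools for the bounds on the off-axis boxes (sibling `…SwirlVanishesBounds`) -/

/-- `|x'| ≤ |y'| + ‖x - y‖` (`|x'| = |Jx|`, `J` linear, `|J v| ≤ ‖v‖`). [folklore] -/
theorem cylRadius_le_cylRadius_add_norm_sub'' (x y : EuclideanSpace ℝ (Fin 3)) :
    cylRadius x ≤ cylRadius y + ‖x - y‖ := by
  have e : ∀ v : EuclideanSpace ℝ (Fin 3), ‖rotGen v‖ = cylRadius v := fun v => norm_rotGen v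
  have h1 : rotGen x = rotGen y + rotGen (x - y) := by
    rw [← rotGenL_apply, ← rotGenL_apply, ← rotGenL_apply, map_sub]
    abel
  calc cylRadius x = ‖rotGen x‖ := (e x).symm
    _ ≤ ‖rotGen y‖ + ‖rotGen (x - y)‖ := by
        rw [h1]
        exact norm_add_le _ _
    _ = cylRadius y + cylRadius (x - y) := by rw [e, e]
    _ ≤ cylRadius y + ‖x - y‖ := by
        have := SereginZajaczkowski2007.cylRadius_le_norm' (x - y)
        linarith

/-- A sequence with unbounded values of `F` cannot accumulate at a point near which `F` is
bounded along the sequence. [folklore] -/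
theorem false_of_eventually_norm_le_of_lt {X : Type*} {F : X → ℝ} {x : ℕ → X} {φ : ℕ → ℕ}
    (hφ : StrictMono φ) (hx : ∀ k : ℕ, (k : ℝ) < F (x k)) {B : ℝ}
    (hB : ∀ᶠ k in atTop, F (x (φ k)) ≤ B) : False := by
  obtain ⟨k₀, hk₀⟩ := eventually_atTop.1 hB
  set k : ℕ := max k₀ ⌈B⌉₊ with hk
  have h1 : F (x (φ k)) ≤ B := hk₀ k (le_max_left _ _)
  have h2 : (φ k : ℝ) < F (x (φ k)) := hx (φ k)
  have h3 : (k : ℝ) ≤ (φ k : ℝ) := by exact_mod_cast hφ.le_apply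
  have h4 : B ≤ (k : ℝ) := (Nat.le_ceil B).trans (by exact_mod_cast le_max_right _ _)
  linarith

/-! ### The global representative -/

/-- **One smooth representative of the ancient limit off its backward-singular set.** Let
`(w, π)` be an Albritton–Barker suitable weak solution in every `Q(a)`, `a > 0`, with all slices
`w s` axisymmetric ((𝒜)(i)–(ii)), and `Σ = {(t, x) | t ≤ 0 ∧ ¬ ∃ r > 0, w ∈ L_∞(Q((t,x), r))}`.
Then there is ONE field `V` with `w = V` a.e. on every `Q(a)` and such that `(V, π)` is a
"sufficiently smooth axially symmetric solution" (`IsSmoothAxisymmetricSolutionOn O V π`: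
suitable, axisymmetric at every point, slices `C^∞`, all spatial derivatives locally Hölder
continuous in space–time) on every rotation invariant open `O ⊆ Q(a) ∖ Σ`, `a > 0`. Proof: on
`Sₙ = Q(n+1) ∖ Σ` (open since `Σ` is closed, rotation invariant since `Σ ⊆ {x' = 0}`, made of
regular points by `isRegularPoint_of_backward_bounded`) take the representative `Vₙ` of
`exists_isSmoothAxisymmetricSolutionOn_of_regular`; two of them agree on the overlap (continuous,
a.e. equal, open set), so `V(t, x) = V_{⌈‖x‖+|t|⌉₊}(t, x)` agrees with every `Vₙ` on `Sₙ`.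
[cite: Seregin2020, proof of Thm 2.1, structure of S^Γ (arXiv p. 7)] -/
theorem exists_smooth_repr_off_backwardSingular :
    ∀ (w : ℝ → EuclideanSpace ℝ (Fin 3) → EuclideanSpace ℝ (Fin 3))
      (π : ℝ → EuclideanSpace ℝ (Fin 3) → ℝ),
      (∀ s, IsAxisymmetric (w s)) →
      (∀ a : ℝ, 0 < a → IsSuitableWeakSolutionInBall a 0 w π) →
      ∀ A : Set (ℝ × EuclideanSpace ℝ (Fin 3)),
      A = {z : ℝ × EuclideanSpace ℝ (Fin 3) | z.1 ≤ 0 ∧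
        ¬ ∃ r > 0, eLpNorm (uncurry w) ∞ (volume.restrict (parabolicCylinder r z)) < ∞} →
    ∃ V : ℝ → EuclideanSpace ℝ (Fin 3) → EuclideanSpace ℝ (Fin 3),
      (∀ a : ℝ, 0 < a →
        uncurry w =ᵐ[volume.restrict (parabolicCylinder a (0 : ℝ × EuclideanSpace ℝ (Fin 3)))]
          uncurry V) ∧
      ∀ a : ℝ, 0 < a → ∀ O : TopologicalSpace.Opens (ℝ × EuclideanSpace ℝ (Fin 3)),
        (O : Set (ℝ × EuclideanSpace ℝ (Fin 3))) ⊆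
          parabolicCylinder a (0 : ℝ × EuclideanSpace ℝ (Fin 3)) \ A →
        (∀ θ : ℝ, ∀ z ∈ (O : Set (ℝ × EuclideanSpace ℝ (Fin 3))),
          ((z.1, rotZ θ z.2) : ℝ × EuclideanSpace ℝ (Fin 3)) ∈
            (O : Set (ℝ × EuclideanSpace ℝ (Fin 3)))) →
        SereginZajaczkowski2007.IsSmoothAxisymmetricSolutionOn O V π := by
  intro w π hax hball A hA
  obtain ⟨hcl, haxis, -⟩ := ancientLimit_backwardSingular_structure w π hax hball
  rw [← hA] at hcl haxis
  -- ### the open sets `Sₙ = Q(n+1) ∖ Σ` and their representatives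
  set Sn : ℕ → Opens (ℝ × EuclideanSpace ℝ (Fin 3)) := fun n =>
    ⟨parabolicCylinder ((n : ℝ) + 1) (0 : ℝ × EuclideanSpace ℝ (Fin 3)) \ A,
      (isOpen_parabolicCylinder _ _).sdiff hcl⟩ with hSn
  have hSn_coe : ∀ n, ((Sn n : Opens (ℝ × EuclideanSpace ℝ (Fin 3))) :
      Set (ℝ × EuclideanSpace ℝ (Fin 3))) =
      parabolicCylinder ((n : ℝ) + 1) (0 : ℝ × EuclideanSpace ℝ (Fin 3)) \ A := fun n => rfl
  have hnpos : ∀ n : ℕ, (0 : ℝ) < (n : ℝ) + 1 := fun n => by positivity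
  have hrot : ∀ n, ∀ θ : ℝ, ∀ z ∈ (Sn n : Set (ℝ × EuclideanSpace ℝ (Fin 3))),
      ((z.1, rotZ θ z.2) : ℝ × EuclideanSpace ℝ (Fin 3)) ∈
        (Sn n : Set (ℝ × EuclideanSpace ℝ (Fin 3))) := by
    intro n θ z hz
    rw [hSn_coe] at hz ⊢
    exact rot_mem_diff_of_subset_axis haxis (fun θ z hz => rot_mem_parabolicCylinder_zero θ hz) θ hz
  have hreg : ∀ n, ∀ z ∈ (Sn n : Set (ℝ × EuclideanSpace ℝ (Fin 3))), IsRegularPoint w z := by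
    intro n z hz
    rw [hSn_coe] at hz
    have ht : z.1 < 0 := by
      have h := (mem_parabolicCylinder.1 hz.1).1.2
      simpa using h
    have hz2 := hz.2
    rw [hA] at hz2
    simp only [mem_setOf_eq, not_and, not_not] at hz2
    obtain ⟨r, hr, hfin⟩ := hz2 ht.le
    exact isRegularPoint_of_backward_bounded hball ht hr hfin
  have hle : ∀ n, Sn n ≤ parabolicCylinderOpens ((n : ℝ) + 1) (0 : ℝ × EuclideanSpace ℝ (Fin 3)) :=
    fun n z hz => hz.1
  have hex : ∀ n, ∃ V : ℝ → EuclideanSpace ℝ (Fin 3) → EuclideanSpace ℝ (Fin 3),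
      IsSmoothAxisymmetricSolutionOn (Sn n) V π ∧
        uncurry w =ᵐ[volume.restrict (Sn n : Set (ℝ × EuclideanSpace ℝ (Fin 3)))] uncurry V :=
    fun n => exists_isSmoothAxisymmetricSolutionOn_of_regular (hball _ (hnpos n)).1
      (fun z _ => hax z.1) (hle n) (hreg n) (hrot n)
  choose V hV hae using hex
  -- ### the glued field
  set Vg : ℝ → EuclideanSpace ℝ (Fin 3) → EuclideanSpace ℝ (Fin 3) :=
    fun t x => V ⌈‖x‖ + |t|⌉₊ t x with hVg
  have hagree : ∀ n, ∀ z ∈ (Sn n : Set (ℝ × EuclideanSpace ℝ (Fin 3))), Vg z.1 z.2 = V n z.1 z.2 := by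
    intro n z hz
    have ht : z.1 < 0 := by
      have h := (mem_parabolicCylinder.1 ((hSn_coe n).subset hz |>.1)).1.2
      simpa using h
    have hzm : z ∈ (Sn ⌈‖z.2‖ + |z.1|⌉₊ : Set (ℝ × EuclideanSpace ℝ (Fin 3))) := by
      rw [hSn_coe]
      exact ⟨mem_parabolicCylinder_natCeil ht, ((hSn_coe n).subset hz).2⟩
    have hO : IsOpen ((Sn ⌈‖z.2‖ + |z.1|⌉₊ : Set (ℝ × EuclideanSpace ℝ (Fin 3))) ∩
        (Sn n : Set (ℝ × EuclideanSpace ℝ (Fin 3)))) := (Sn _).isOpen.inter (Sn n).isOpen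
    have h1a : uncurry w =ᵐ[volume.restrict
        ((Sn ⌈‖z.2‖ + |z.1|⌉₊ : Set (ℝ × EuclideanSpace ℝ (Fin 3))) ∩
          (Sn n : Set (ℝ × EuclideanSpace ℝ (Fin 3))))] uncurry (V ⌈‖z.2‖ + |z.1|⌉₊) :=
      ae_restrict_of_ae_restrict_of_subset inter_subset_left (hae _)
    have h1b : uncurry w =ᵐ[volume.restrict
        ((Sn ⌈‖z.2‖ + |z.1|⌉₊ : Set (ℝ × EuclideanSpace ℝ (Fin 3))) ∩
          (Sn n : Set (ℝ × EuclideanSpace ℝ (Fin 3))))] uncurry (V n) :=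
      ae_restrict_of_ae_restrict_of_subset inter_subset_right (hae n)
    have h1 := h1a.symm.trans h1b
    have heq := Measure.eqOn_open_of_ae_eq h1 hO
      ((hV _).continuousOn_velocity.mono inter_subset_left)
      ((hV n).continuousOn_velocity.mono inter_subset_right)
    exact heq ⟨hzm, hz⟩
  -- `Q(a) ∖ Σ ⊆ S_{⌈a⌉₊}`
  have hsub : ∀ a : ℝ, 0 < a → parabolicCylinder a (0 : ℝ × EuclideanSpace ℝ (Fin 3)) \ A ⊆
      (Sn ⌈a⌉₊ : Set (ℝ × EuclideanSpace ℝ (Fin 3))) := by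
    intro a ha
    rw [hSn_coe]
    have hle' : a ≤ (⌈a⌉₊ : ℝ) + 1 := (Nat.le_ceil a).trans (by linarith)
    exact sdiff_subset_sdiff_left (parabolicCylinder_mono ha.le hle' _)
  have hAnull : volume A = 0 :=
    measure_mono_null (fun z hz => haxis z hz) volume_setOf_cylRadius_snd_eq_zero
  refine ⟨Vg, fun a ha => ?_, fun a ha O hO hOrot => ?_⟩
  · -- ### `w = V` a.e. on `Q(a)`
    have h1 : ∀ᵐ z ∂(volume : Measure (ℝ × EuclideanSpace ℝ (Fin 3))), z ∉ A :=
      measure_eq_zero_iff_ae_notMem.1 hAnull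
    have h3 := (ae_restrict_iff' (Sn ⌈a⌉₊).isOpen.measurableSet).1 (hae ⌈a⌉₊)
    refine (ae_restrict_iff' (isOpen_parabolicCylinder a _).measurableSet).2 ?_
    filter_upwards [h1, h3] with z hzA hz3 hzQ
    have hzS : z ∈ (Sn ⌈a⌉₊ : Set (ℝ × EuclideanSpace ℝ (Fin 3))) := hsub a ha ⟨hzQ, hzA⟩
    rw [hz3 hzS]
    simp only [uncurry]
    exact (hagree _ z hzS).symm
  · -- ### the class on `O ⊆ Q(a) ∖ Σ`
    have hOn : O ≤ Sn ⌈a⌉₊ := fun z hz => hsub a ha (hO hz)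
    exact isSmoothAxisymmetricSolutionOn_congr ((hV _).of_le hOn) hOrot
      fun z hz => (hagree _ z (hOn hz)).symm

end Summit.NavierStokesRegularity.NavierStokesRegularity.Theorems.AxisymmetricKatoGlobal.EulerScaling

end
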